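import Mathlib
import Summits.CriticalPhenomena.CardyFormulaZ2.Theorems.CardySelfRefinementDefs
import Summits.CriticalPhenomena.CardyFormulaZ2.Theorems.CardySelfRefinementGradientComparabilityStubCornerWindowsDefect
import Summits.CriticalPhenomena.CardyFormulaZ2.Theorems.CardySelfRefinementGradientComparabilityStubNonAxialShareBulkLocal
import Literature.Probability.Percolation.SelfRefinementMeasure
import HarnessLib

/-!
# Crux `GradientComparability` (stmt-CriticalPhenomena-10269), line `monotone-product-coordinates` —
# support for stub `stub_cornerWindows`, part 4 (brick S2): on `{c = 0}` the bulk defect vanishes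

Route `CardySelfRefinement`, sub-problem `CriticalPhenomena/CardyFormulaZ2`; vocabulary from
`CardySelfRefinementDefs` (`ax tb cfg prm M Aloc window edgeOf`); the canonical enumeration of a
bundle and the defect terms of part 3 (`…StubCornerWindowsDefect`: `bundle_param_canonical`,
`Drho_eq_sum_half_pivotal_sub_defect`); the closure-semantics surgery kit of
`…StubNonAxialShareBulk{Topology,Reroute,Surgery}` (`not_crossing_of_links`, `segment_disjoint_of_ne`,
`mem_configOf_iff_exists_isCrossing_openEdgeUnion`).

## Mathematics

Fix the bundle `(t, d)` with canonical vertices `p j = k•t + j e_d` (`j ≤ k`), sub-edges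
`e_j = {p j, p (j+1)}` (`j < k`), `B = {e_j}`, and a PROPER pattern `J ⊊ [k]`, `j₀ ∉ J`; the defect
term of `Drho_eq_sum_half_pivotal_sub_defect` for `(B, J)` is `M(A^J ∖ A^∅)`,
`A^J = {ω | (ω ∖ B) ∪ {e_j | j ∈ J} ∈ Aloc}`.  On `{c = 0}` the own coin of a non-axial edge has
bias `projIcc 0 1 0 = 0`, so `M_k(ρ,0)`-a.s. (any real `ρ`, the corner `ρ = 1` included) no
non-axial edge is open (`ae_forall_not_ax_notMem_cfg`), and an interior vertex `p j`, `0 < j < k`,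
whose perpendicular edges are non-axial, carries no open edge off `B`
(`notMem_sdiff_bundle_of_interior`).  If the `k + 1` vertices are at drawn distance `≥ r ≥ 2η` from
every side of every quad, the drawn sub-edges avoid `∂₀F_i ∪ ∂₂F_i` and the deterministic heart
`crossing_of_crossing_union_brokenChain` applies: for a simple lattice path `p 0, …, p k` whose
interior vertices are isolated in `τ` and a set `C` of its edges missing `e_{j₀}`, a crossing of a
quad inside the drawing of `τ ∪ C` yields one inside the drawing of `τ` — in path form
(`exists_isCrossing_iff_joinedIn`) the new drawing is entered from the old one only at `p 0`, `p k`,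
which `C` does not join; the case analysis on the links of `p 0`, `p k` to `∂₀`, `∂₂` is settled by
`not_crossing_of_links`.  So `A^J ∖ A^∅` lies in the null event "some non-axial edge is open"
(`real_section_sdiff_eq_zero_of_far_c0`), and the pattern sum of a far bundle collapses to its top
term `M(B set-pivotal)` (`sum_real_section_sdiff_eq_pivotal_of_far_c0`, registered): far bundles
contribute exactly `2^{-k} N_far` to the left side of hypothesis (D0) of
`cornerWindow_c0_of_pivotalWindow_of_defectBound` (`selectorInfl_eq_of_defect_zero`: their selector
influences are `(½ − 2^{-k}) M(B set-pivotal) ≥ 0`).  No percolation estimate, no named fact.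
-/

noncomputable section

namespace Summit.CriticalPhenomena.CardyFormulaZ2.Theorems.CardySelfRefinement

open scoped Topology
open Filter Set MeasureTheory
open Literature.Probability.LatticeModels Literature.Probability.Percolation
open Literature.Probability.Percolation.QuadCrossing
open Summit.CriticalPhenomena.CardyFormulaZ2.Theses.CardySelfRefinement

variable {D : Set ℂ} {δ : ℝ}

/-! ## The deterministic heart: opening a broken chain creates no crossing -/

/-- **Opening a broken chain creates no crossing.**  Let `p 0, …, p k` be a simple lattice path
whose interior vertices `p j` (`0 < j < k`) carry no edge of `τ`, and let `C` be a set of its edges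
`{p j, p (j+1)}` missing the edge of index `j₀ < k`, none of them in `τ`, drawn off `∂₀Q ∪ ∂₂Q`.
Then every crossing of `Q` inside the drawing of `τ ∪ C` (path form) yields one inside the drawing
of `τ`: the new drawing can be entered from the old one only at `p 0` and `p k`, and the two halves
of `C` (indices `< j₀`, `> j₀`) do not join them. -/
theorem crossing_of_crossing_union_brokenChain (hδ : 0 < δ) (Q : Quad D) {τ C : BondConfig (Site 2)}
    {p : ℕ → Site 2} {k j₀ : ℕ} (hj₀ : j₀ < k)
    (hadj : ∀ j, j < k → (zdGraph 2).Adj (p j) (p (j + 1)))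
    (hinj : ∀ j j', j ≤ k → j' ≤ k → p j = p j' → j = j')
    (hC : ∀ f ∈ C, ∃ j, j < k ∧ j ≠ j₀ ∧ f = s(p j, p (j + 1)))
    (hCτ : ∀ f ∈ C, f ∉ τ)
    (hiso : ∀ j, 0 < j → j < k → ∀ y, (zdGraph 2).Adj (p j) y → s(p j, y) ∉ τ)
    (hbulk : ∀ z ∈ openEdgeUnion δ C, z ∉ Q.side 0 ∧ z ∉ Q.side 2)
    (hcr : ∃ a ∈ Q.side 0, ∃ b ∈ Q.side 2, JoinedIn (Q.carrier ∩ openEdgeUnion δ (τ ∪ C)) a b) :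
    ∃ a ∈ Q.side 0, ∃ b ∈ Q.side 2, JoinedIn (Q.carrier ∩ openEdgeUnion δ τ) a b := by
  by_contra hτ
  -- the two halves of the chain
  set Sa : BondConfig (Site 2) := {f ∈ C | ∃ j, j < j₀ ∧ f = s(p j, p (j + 1))} with hSa
  set Sb : BondConfig (Site 2) := {f ∈ C | ∃ j, j₀ < j ∧ j < k ∧ f = s(p j, p (j + 1))} with hSb
  have hCab : C = Sa ∪ Sb := by
    refine Set.Subset.antisymm (fun f hf => ?_) (Set.union_subset (fun f hf => hf.1) fun f hf => hf.1)
    obtain ⟨j, hj, hjne, rfl⟩ := hC f hf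
    rcases lt_or_gt_of_ne hjne with h | h
    exacts [Or.inl ⟨hf, j, h, rfl⟩, Or.inr ⟨hf, j, h, hj, rfl⟩]
  set G : Set ℂ := Q.carrier ∩ openEdgeUnion δ τ with hG
  -- interior vertices are joined to nothing; the live ends of the two halves are `p 0`, `p k`
  have hisoJ : ∀ j, 0 < j → j < k → ∀ a, ¬ JoinedIn G a (meshPoint δ (p j)) := fun j hj hjk a =>
    not_joinedIn_of_isolated hδ Q (hiso j hj hjk) a
  have hendsA : ∀ x x', s(x, x') ∈ Sa → x = p 0 ∨ ∀ a, ¬ JoinedIn G a (meshPoint δ x) := by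
    rintro x x' ⟨-, j, hj, hf⟩
    rcases eq_or_eq_of_sym2_eq hf with rfl | rfl
    · rcases Nat.eq_zero_or_pos j with rfl | hj0
      exacts [Or.inl rfl, Or.inr (hisoJ j hj0 (hj.trans hj₀))]
    · exact Or.inr (hisoJ (j + 1) j.succ_pos (by omega))
  have hendsB : ∀ x x', s(x, x') ∈ Sb → x = p k ∨ ∀ a, ¬ JoinedIn G a (meshPoint δ x) := by
    rintro x x' ⟨-, j, hj, hjk, hf⟩
    rcases eq_or_eq_of_sym2_eq hf with rfl | rfl
    · exact Or.inr (hisoJ j (by omega) hjk)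
    · by_cases h : j + 1 = k
      exacts [Or.inl (by rw [h]), Or.inr (hisoJ (j + 1) j.succ_pos (by omega))]
  -- the common hypotheses of `not_crossing_of_links`
  have hne : ∀ i i', i ≤ k → i' ≤ k → i ≠ i' → p i ≠ p i' := fun i i' hi hi' hii' h =>
    hii' (hinj i i' hi hi' h)
  have hseg : ∀ {x y : Site 2} {j : ℕ} {z : ℂ}, s(x, y) = s(p j, p (j + 1)) →
      z ∈ segment ℝ (meshPoint δ x) (meshPoint δ y) →
      z ∈ segment ℝ (meshPoint δ (p j)) (meshPoint δ (p (j + 1))) := fun hf hzs => by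
    rcases Sym2.eq_iff.1 hf with ⟨rfl, rfl⟩ | ⟨rfl, rfl⟩
    exacts [hzs, by rw [segment_symm]; exact hzs]
  have hAB : ∀ z ∈ openEdgeUnion δ Sa, z ∉ openEdgeUnion δ Sb := by
    intro z hz hz'
    obtain ⟨x, y, -, ⟨-, j, hj, hf⟩, hzs⟩ := mem_openEdgeUnion_iff.1 hz
    obtain ⟨x', y', -, ⟨-, j', hj', hj'k, hf'⟩, hzs'⟩ := mem_openEdgeUnion_iff.1 hz'
    exact segment_disjoint_of_ne hδ.ne' (hadj j (hj.trans hj₀)) (hadj j' hj'k)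
      (hne _ _ (by omega) (by omega) (by omega)) (hne _ _ (by omega) (by omega) (by omega))
      (hne _ _ (by omega) (by omega) (by omega)) (hne _ _ (by omega) (by omega) (by omega))
      (hseg hf hzs) (hseg hf' hzs')
  have hbulk' : ∀ z ∈ openEdgeUnion δ (Sa ∪ Sb), z ∉ Q.side 0 ∧ z ∉ Q.side 2 := by
    rw [← hCab]; exact hbulk
  have hcr' : ∃ a ∈ Q.side 0, ∃ b ∈ Q.side 2,
      JoinedIn (Q.carrier ∩ openEdgeUnion δ (τ ∪ Sa ∪ Sb)) a b := by
    rw [Set.union_assoc, ← hCab]; exact hcr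
  -- two links of one point give a crossing of `τ`
  have htwo : ∀ v : Site 2, (∃ a ∈ Q.side 0, JoinedIn G a (meshPoint δ v)) →
      (∃ b ∈ Q.side 2, JoinedIn G b (meshPoint δ v)) → False := fun v h0 h2 =>
    hτ (crossing_of_two_links Q (jp := 0) (jq := 2) (Or.inl ⟨rfl, rfl⟩) h0 h2)
  -- (I) one block: a side `∂_{jq}Q` linked neither to `p 0` nor to `p k`
  have hblock : ∀ jp jq : Fin 4, ((jp = 0 ∧ jq = 2) ∨ (jp = 2 ∧ jq = 0)) →
      (¬ ∃ b ∈ Q.side jq, JoinedIn G b (meshPoint δ (p 0))) →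
      (¬ ∃ b ∈ Q.side jq, JoinedIn G b (meshPoint δ (p k))) → False := by
    intro jp jq hj h0 hk
    refine not_crossing_of_links hδ Q (Sp := C) (Sq := ∅) hj hτ hCτ
      (fun f hf => absurd hf (Set.notMem_empty _)) (fun z _ hz => ?_)
      (by rw [Set.union_empty]; exact hbulk) ?_
      (fun y y' _ hy => absurd hy (Set.notMem_empty _))
      (fun x x' y y' _ _ _ hy => absurd hy (Set.notMem_empty _)) (by rwa [Set.union_empty])
    · exact (let ⟨_, _, _, h, _⟩ := mem_openEdgeUnion_iff.1 hz; absurd h (Set.notMem_empty _))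
    · intro x x' _ hx hL
      rw [hCab] at hx
      rcases hx with hx | hx
      · rcases hendsA x x' hx with rfl | hxi
        exacts [h0 hL, let ⟨b, _, hJ⟩ := hL; hxi b hJ]
      · rcases hendsB x x' hx with rfl | hxi
        exacts [hk hL, let ⟨b, _, hJ⟩ := hL; hxi b hJ]
  -- (II) split: `p 0` not linked to `∂_{jq}Q`, `p k` not to `∂_{jp}Q`, and the two not joined
  have hsplit : ∀ jp jq : Fin 4, ((jp = 0 ∧ jq = 2) ∨ (jp = 2 ∧ jq = 0)) →
      (¬ ∃ b ∈ Q.side jq, JoinedIn G b (meshPoint δ (p 0))) →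
      (¬ ∃ a ∈ Q.side jp, JoinedIn G a (meshPoint δ (p k))) →
      ¬ JoinedIn G (meshPoint δ (p 0)) (meshPoint δ (p k)) → False := by
    intro jp jq hj h0 hk hJ
    refine not_crossing_of_links hδ Q (Sp := Sa) (Sq := Sb) hj hτ (fun f hf => hCτ f hf.1)
      (fun f hf => hCτ f hf.1) hAB hbulk' ?_ ?_ ?_ hcr'
    · intro x x' _ hx hL
      rcases hendsA x x' hx with rfl | hxi
      exacts [h0 hL, let ⟨b, _, hJ'⟩ := hL; hxi b hJ']
    · intro y y' _ hy hL
      rcases hendsB y y' hy with rfl | hyi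
      exacts [hk hL, let ⟨a, _, hJ'⟩ := hL; hyi a hJ']
    · intro x x' y y' _ hx _ hy hJ'
      rcases hendsA x x' hx with rfl | hxi
      · rcases hendsB y y' hy with rfl | hyi
        exacts [hJ hJ', hyi _ hJ']
      · exact hxi _ hJ'.symm
  -- the case analysis on the links of `p 0` and `p k` to `∂₂Q`
  by_cases hA : ∃ b ∈ Q.side 2, JoinedIn G b (meshPoint δ (p 0))
  · have hA0 : ¬ ∃ a ∈ Q.side 0, JoinedIn G a (meshPoint δ (p 0)) := fun h => htwo _ h hA
    by_cases hB : ∃ b ∈ Q.side 2, JoinedIn G b (meshPoint δ (p k))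
    · exact hblock 2 0 (Or.inr ⟨rfl, rfl⟩) hA0 fun h => htwo _ h hB
    · exact hsplit 2 0 (Or.inr ⟨rfl, rfl⟩) hA0 hB fun hJ => hB (link_of_joinedIn hA hJ)
  · by_cases hB : ∃ b ∈ Q.side 2, JoinedIn G b (meshPoint δ (p k))
    · exact hsplit 0 2 (Or.inl ⟨rfl, rfl⟩) hA (fun h => htwo _ h hB) fun hJ =>
        hA (link_of_joinedIn hB hJ.symm)
    · exact hblock 0 2 (Or.inl ⟨rfl, rfl⟩) hA hB

/-! ## The canonical chain of a bundle: vertices `p j = k•t + j e_d` -/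

/-- Consecutive canonical bundle vertices differ by the direction vector `e_d`. -/
theorem bundleVertex_succ (k : ℕ) (t : Site 2) (d : Fin 2) (j : ℕ) :
    ((fun l => (k : ℤ) * t l + if l = d then ((j + 1 : ℕ) : ℤ) else 0) : Site 2) =
      (fun l => (k : ℤ) * t l + if l = d then (j : ℤ) else 0) + dirVec d := by
  rw [show (dirVec d : Site 2) = Pi.single d 1 from dirVec_eq_single d]
  funext l
  by_cases hl : l = d
  · subst hl
    simp [add_assoc]
  · simp [hl]

/-- The canonical chain is a lattice path. -/
theorem bundleVertex_adj (k : ℕ) (t : Site 2) (d : Fin 2) (j : ℕ) :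
    (zdGraph 2).Adj ((fun l => (k : ℤ) * t l + if l = d then (j : ℤ) else 0) : Site 2)
      (fun l => (k : ℤ) * t l + if l = d then ((j + 1 : ℕ) : ℤ) else 0) := by
  rw [bundleVertex_succ, zdGraph_adj_iff]
  exact ⟨d, Or.inl (by rw [show (dirVec d : Site 2) = Pi.single d 1 from dirVec_eq_single d])⟩

/-- The canonical chain is simple. -/
theorem bundleVertex_injective (k : ℕ) (t : Site 2) (d : Fin 2) {j j' : ℕ}
    (h : ((fun l => (k : ℤ) * t l + if l = d then (j : ℤ) else 0) : Site 2) =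
      fun l => (k : ℤ) * t l + if l = d then (j' : ℤ) else 0) : j = j' := by
  simpa using congrFun h d

/-- The `j`-th sub-edge joins the `j`-th and `(j+1)`-st vertices of the chain. -/
theorem edgeOf_bundleVertex (k : ℕ) (t : Site 2) (d : Fin 2) (j : ℕ) :
    edgeOf ((fun l => (k : ℤ) * t l + if l = d then (j : ℤ) else 0), d) =
      s(((fun l => (k : ℤ) * t l + if l = d then (j : ℤ) else 0) : Site 2),
        fun l => (k : ℤ) * t l + if l = d then ((j + 1 : ℕ) : ℤ) else 0) := by
  rw [bundleVertex_succ]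

/-- The sub-edges belong to the bundle (the axial edges of direction `d` and coarse base `t`). -/
theorem edgeOf_bundleVertex_mem {k : ℕ} (hk : 0 < k) (t : Site 2) (d : Fin 2) {j : ℕ}
    (hj : j < k) :
    edgeOf ((fun l => (k : ℤ) * t l + if l = d then (j : ℤ) else 0), d) ∈
      edgeOf '' {vd : Site 2 × Fin 2 | ax k vd ∧ tb k vd = t ∧ vd.2 = d} :=
  Set.mem_image_of_mem edgeOf
    ⟨((bundle_param_canonical hk t d).1 j hj).1, ((bundle_param_canonical hk t d).1 j hj).2, rfl⟩

/-- An edge in the direction `i ≠ d` based at a point whose `d`-coordinate is `k t_d + j` with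
`0 < j < k` is not axial. -/
theorem not_ax_of_interior {k : ℕ} {t : Site 2} {d i : Fin 2} (hid : i ≠ d) {j : ℕ} (hj0 : 0 < j)
    (hjk : j < k) {y : Site 2} (hy : y d = (k : ℤ) * t d + j) : ¬ ax k (y, i) := by
  have hcoord : (if i = 0 then (1 : Fin 2) else 0) = d := by
    revert hid
    fin_cases i <;> fin_cases d <;> decide
  intro h
  have h' : (k : ℤ) ∣ y (if i = 0 then 1 else 0) := h
  rw [hcoord, hy] at h'
  have h1 : (k : ℤ) ≤ j :=
    Int.le_of_dvd (by exact_mod_cast hj0) ((dvd_add_right (dvd_mul_right _ _)).1 h')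
  omega

/-- **Interior vertices dangle.**  In a configuration without open non-axial edges, an interior
vertex `p j` (`0 < j < k`) of the bundle carries no open edge off the bundle: its two edges along
the bundle are sub-edges, its two perpendicular edges are non-axial. -/
theorem notMem_sdiff_bundle_of_interior {k : ℕ} (hk : 0 < k) (t : Site 2) (d : Fin 2) {j : ℕ}
    (hj0 : 0 < j) (hjk : j < k) {ω : BondConfig (Site 2)}
    (hgood : ∀ vd : Site 2 × Fin 2, ¬ ax k vd → edgeOf vd ∉ ω) {y : Site 2}
    (hy : (zdGraph 2).Adj ((fun l => (k : ℤ) * t l + if l = d then (j : ℤ) else 0) : Site 2) y) :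
    s(((fun l => (k : ℤ) * t l + if l = d then (j : ℤ) else 0) : Site 2), y) ∉
      ω \ edgeOf '' {vd : Site 2 × Fin 2 | ax k vd ∧ tb k vd = t ∧ vd.2 = d} := by
  rintro ⟨hω, hB⟩
  have hpd : ((fun l => (k : ℤ) * t l + if l = d then (j : ℤ) else 0) : Site 2) d = (k : ℤ) * t d + j := by
    simp
  obtain ⟨i, hi | hi⟩ := (zdGraph_adj_iff _ _).1 hy
  · -- `y = p j + e_i`: the edge is `edgeOf (p j, i)`
    have he : s(((fun l => (k : ℤ) * t l + if l = d then (j : ℤ) else 0) : Site 2), y) =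
        edgeOf ((fun l => (k : ℤ) * t l + if l = d then (j : ℤ) else 0), i) := by
      rw [hi, ← show (dirVec i : Site 2) = Pi.single i 1 from dirVec_eq_single i]
    rw [he] at hω hB
    by_cases hid : i = d
    · subst hid
      exact hB (edgeOf_bundleVertex_mem hk t i hjk)
    · exact hgood _ (not_ax_of_interior hid hj0 hjk hpd) hω
  · -- `p j = y + e_i`: the edge is `edgeOf (y, i)`
    have he : s(((fun l => (k : ℤ) * t l + if l = d then (j : ℤ) else 0) : Site 2), y) =
        edgeOf (y, i) := by
      rw [Sym2.eq_swap, hi, ← show (dirVec i : Site 2) = Pi.single i 1 from dirVec_eq_single i]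
    rw [he] at hω hB
    by_cases hid : i = d
    · subst hid
      obtain ⟨j', rfl⟩ := Nat.exists_eq_succ_of_ne_zero hj0.ne'
      have hy' : y = fun l => (k : ℤ) * t l + if l = i then (j' : ℤ) else 0 := by
        rw [bundleVertex_succ, show (dirVec i : Site 2) = Pi.single i 1 from dirVec_eq_single i] at hi
        exact (add_right_cancel hi).symm
      subst hy'
      exact hB (edgeOf_bundleVertex_mem hk t i (by omega))
    · have hyd : y d = (k : ℤ) * t d + j := by
        have h := congrFun hi d
        simp [Ne.symm hid] at h
        linarith
      exact hgood _ (not_ax_of_interior hid hj0 hjk hyd) hω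

/-! ## The slice `c = 0`: non-axial edges are almost surely closed -/

/-- On the slice `c = 0` the own coin of a non-axial edge has bias `projIcc 0 1 0 = 0`: almost
surely (for the coin law at `(ρ, 0)`, any real `ρ`) no non-axial edge is open in the read-out. -/
theorem ae_forall_not_ax_notMem_cfg (k : ℕ) (ρ : ℝ) :
    ∀ᵐ S ∂prodBernoulli (prm k ρ 0), ∀ vd : Site 2 × Fin 2, ¬ ax k vd → edgeOf vd ∉ cfg k S := by
  have h : ∀ᵐ S ∂prodBernoulli (prm k ρ 0), ∀ e : Site 2 × Fin 2, ¬ IsAxialEdge k e →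
      (e.1, e.2, (0 : Fin 3)) ∉ S := ae_forall_interior_notMem k ρ
  filter_upwards [h] with S hS
  intro vd hvd hmem
  have hopn := (edgeOf_mem_cfg_iff_opn k S vd).1 hmem
  simp only [opn, hvd, if_false] at hopn
  exact hS vd hvd hopn

/-! ## The defect of a far bundle vanishes on `{c = 0}` -/

/-- **Deterministic core (one configuration).**  Let `0 < k`, `0 < η`, `2η ≤ r`, let the `k + 1`
canonical vertices of the bundle `(t, d)` be at drawn distance `≥ r` from every side of every quad,
let `J ⊆ [k]` miss `j₀ < k`, and let `ω` have no open non-axial edge.  If `(ω ∖ B) ∪ {e_j | j ∈ J}`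
lies in the localised joint crossing event `Aloc`, then so does `ω ∖ B` (`B` = the bundle as a set
of edges): the partial pattern dangles. -/
theorem sdiff_bundle_mem_Aloc_of_union_pattern {k m : ℕ} (hk : 0 < k)
    (F : Fin m → Quad (Set.univ : Set ℂ)) {η r : ℝ} (hη : 0 < η) (hηr : 2 * η ≤ r) (t : Site 2) (d : Fin 2)
    (hfar : ∀ j, j ≤ k → ∀ (i : Fin m) (jj : Fin 4), ∀ q ∈ (F i).side jj,
      r ≤ dist ((η : ℂ) * squareLatticeEmbedding.z (fun l => (k : ℤ) * t l + if l = d then (j : ℤ) else 0)) q)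
    {J : Finset ℕ} (hJ : J ⊆ Finset.range k) {j₀ : ℕ} (hj₀ : j₀ < k) (hj₀J : j₀ ∉ J)
    {ω : BondConfig (Site 2)} (hgood : ∀ vd : Site 2 × Fin 2, ¬ ax k vd → edgeOf vd ∉ ω)
    (hin : ω \ edgeOf '' {vd : Site 2 × Fin 2 | ax k vd ∧ tb k vd = t ∧ vd.2 = d} ∪
      ↑(J.image fun j : ℕ => edgeOf ((fun l => (k : ℤ) * t l + if l = d then (j : ℤ) else 0), d)) ∈
        Aloc m F η) :
    ω \ edgeOf '' {vd : Site 2 × Fin 2 | ax k vd ∧ tb k vd = t ∧ vd.2 = d} ∈ Aloc m F η := by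
  classical
  set Bset : Set (Sym2 (Site 2)) := edgeOf '' {vd : Site 2 × Fin 2 | ax k vd ∧ tb k vd = t ∧ vd.2 = d}
  set CJ : Set (Sym2 (Site 2)) :=
    ↑(J.image fun j : ℕ => edgeOf ((fun l => (k : ℤ) * t l + if l = d then (j : ℤ) else 0), d)) with hCJ
  set W : Set (Sym2 (Site 2)) := window m F η with hW_def
  have hW : W ⊆ (zdGraph 2).edgeSet := Set.iUnion_subset fun i => Set.inter_subset_right
  set dd : ℝ := η * Real.sqrt 2 with hdd_def
  have hsqrt : Real.sqrt 2 < 2 := (Real.sqrt_lt' (by norm_num)).2 (by norm_num)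
  obtain ⟨hdd, hddr⟩ : 0 < dd ∧ dd < r := ⟨by positivity, by rw [hdd_def]; nlinarith⟩
  set τ : BondConfig (Site 2) := ω \ Bset ∩ W with hτ_def
  set C : BondConfig (Site 2) := CJ ∩ W with hC_def
  have hτE : τ ⊆ (zdGraph 2).edgeSet := Set.inter_subset_right.trans hW
  have hτCE : τ ∪ C ⊆ (zdGraph 2).edgeSet := Set.union_subset hτE (Set.inter_subset_right.trans hW)
  have hin' : ∀ i, F i ∈ configOf squareLatticeEmbedding.z η Set.univ (τ ∪ C) := by
    have h : ∀ i, F i ∈ configOf squareLatticeEmbedding.z η Set.univ ((ω \ Bset ∪ CJ) ∩ W) := hin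
    rwa [Set.union_inter_distrib_right] at h
  show ∀ i, F i ∈ configOf squareLatticeEmbedding.z η Set.univ τ
  intro i
  rw [mem_configOf_iff_exists_isCrossing_openEdgeUnion hη hτE, exists_isCrossing_iff_joinedIn hdd]
  have hcr := (mem_configOf_iff_exists_isCrossing_openEdgeUnion hη hτCE (F i)).1 (hin' i)
  rw [exists_isCrossing_iff_joinedIn hdd] at hcr
  refine crossing_of_crossing_union_brokenChain hdd (F i)
    (p := fun j l => (k : ℤ) * t l + if l = d then (j : ℤ) else 0) hj₀
    (fun j _ => bundleVertex_adj k t d j) (fun j j' _ _ h => bundleVertex_injective k t d h)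
    ?_ ?_ (fun j hj0 hjk y hy hmem => notMem_sdiff_bundle_of_interior hk t d hj0 hjk hgood hy hmem.1)
    ?_ hcr
  · -- the new edges are sub-edges of index `≠ j₀`
    rintro f ⟨hf, -⟩
    obtain ⟨j, hj, rfl⟩ := Finset.mem_image.1 (Finset.mem_coe.1 hf)
    exact ⟨j, Finset.mem_range.1 (hJ hj), fun h => hj₀J (h ▸ hj), edgeOf_bundleVertex k t d j⟩
  · -- they are not in `τ`
    rintro f ⟨hf, -⟩ ⟨⟨-, hfB⟩, -⟩
    obtain ⟨j, hj, rfl⟩ := Finset.mem_image.1 (Finset.mem_coe.1 hf)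
    exact hfB (edgeOf_bundleVertex_mem hk t d (Finset.mem_range.1 (hJ hj)))
  · -- the new drawing avoids `∂₀` and `∂₂`
    intro z hz
    obtain ⟨x, y, hxy, ⟨hf, -⟩, hzs⟩ := mem_openEdgeUnion_iff.1 hz
    obtain ⟨j, hj, hfe⟩ := Finset.mem_image.1 (Finset.mem_coe.1 hf)
    have hjk := Finset.mem_range.1 (hJ hj)
    rw [edgeOf_bundleVertex] at hfe
    obtain ⟨j', hj'k, hx⟩ : ∃ j', j' ≤ k ∧
        x = fun l => (k : ℤ) * t l + if l = d then (j' : ℤ) else 0 := by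
      rcases eq_or_eq_of_sym2_eq hfe.symm with h | h
      exacts [⟨j, hjk.le, h⟩, ⟨j + 1, hjk, h⟩]
    subst hx
    have hdist := dist_meshPoint_le_of_mem_segment hdd hxy hzs
    have key : ∀ jj : Fin 4, z ∉ (F i).side jj := fun jj hzj => by
      have h1 : r ≤ dist (meshPoint dd fun l => (k : ℤ) * t l + if l = d then (j' : ℤ) else 0) z := by
        rw [← eta_mul_z_eq_meshPoint]
        exact hfar j' hj'k i jj z hzj
      linarith
    exact ⟨key 0, key 2⟩

/-- **Brick S2, per pattern: on the slice `c = 0` every proper-pattern defect term of a far bundle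
vanishes** (the currency of `Drho_eq_sum_half_pivotal_sub_defect`).  For every `k`, quad family `F`,
mesh `0 < η` with `2η ≤ r`, every real `ρ` (the corner `ρ = 1` included), every bundle `(t, d)` whose
`k + 1` canonical vertices `k•t + j e_d` (`j ≤ k`) are at drawn distance `≥ r` from every side of
every quad, and every PROPER pattern `J ⊊ [k]`:
`M_k(ρ,0)({ω | (ω ∖ B) ∪ {e_j | j ∈ J} ∈ Aloc} ∖ {ω | ω ∖ B ∈ Aloc}) = 0` — almost surely no
non-axial edge is open, so the partial pattern dangles off `ω ∖ B` and creates no crossing. -/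
theorem real_section_sdiff_eq_zero_of_far_c0 : ∀ (k m : ℕ) (F : Fin m → Quad (Set.univ : Set ℂ)) {η r : ℝ}, 0 < η → 2 * η ≤ r → ∀ (ρ : ℝ) (t : Site 2) (d : Fin 2), (∀ j, j ≤ k → ∀ (i : Fin m) (jj : Fin 4), ∀ q ∈ (F i).side jj, r ≤ dist ((η : ℂ) * squareLatticeEmbedding.z (fun l => (k : ℤ) * t l + if l = d then (j : ℤ) else 0)) q) → ∀ J ∈ (Finset.range k).powerset, J ≠ Finset.range k → (M k ρ 0).real ({ω | ω \ edgeOf '' {vd : Site 2 × Fin 2 | ax k vd ∧ tb k vd = t ∧ vd.2 = d} ∪ ↑(J.image fun j : ℕ => edgeOf ((fun l => (k : ℤ) * t l + if l = d then (j : ℤ) else 0), d)) ∈ Aloc m F η} \ {ω | ω \ edgeOf '' {vd : Site 2 × Fin 2 | ax k vd ∧ tb k vd = t ∧ vd.2 = d} ∈ Aloc m F η}) = 0 := by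
  intro k m F η r hη hηr ρ t d hfar J hJ hJne
  classical
  have hJsub : J ⊆ Finset.range k := Finset.mem_powerset.1 hJ
  obtain ⟨j₀, hj₀, hj₀J⟩ := Finset.exists_of_ssubset (Finset.ssubset_iff_subset_ne.2 ⟨hJsub, hJne⟩)
  have hj₀k : j₀ < k := Finset.mem_range.1 hj₀
  have hk : 0 < k := lt_of_le_of_lt (Nat.zero_le _) hj₀k
  have hηne : η ≠ 0 := hη.ne'
  set Bset : Set (Sym2 (Site 2)) := edgeOf '' {vd : Site 2 × Fin 2 | ax k vd ∧ tb k vd = t ∧ vd.2 = d}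
  set CJ : Set (Sym2 (Site 2)) :=
    ↑(J.image fun j : ℕ => edgeOf ((fun l => (k : ℤ) * t l + if l = d then (j : ℤ) else 0), d)) with hCJ
  have hX : MeasurableSet {ω : BondConfig (Site 2) | ω \ Bset ∪ CJ ∈ Aloc m F η} :=
    measurableSet_section_bundle m F hηne Bset CJ
  have hY : MeasurableSet {ω : BondConfig (Site 2) | ω \ Bset ∈ Aloc m F η} := by
    simpa using measurableSet_section_bundle m F hηne Bset ∅
  rw [map_measureReal_apply (measurable_cfg k) (hX.diff hY),
    measureReal_eq_zero_iff (measure_ne_top _ _), measure_eq_zero_iff_ae_notMem]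
  filter_upwards [ae_forall_not_ax_notMem_cfg k ρ] with S hS
  rintro ⟨hXS, hYS⟩
  exact hYS (sdiff_bundle_mem_Aloc_of_union_pattern hk F hη hηr t d hfar hJsub hj₀k hj₀J hS hXS)

/-- **Brick S2 of `stub_cornerWindows`, summed over the patterns** (registered helper; the bulk part of
hypothesis (D0) of `cornerWindow_c0_of_pivotalWindow_of_defectBound`): for `0 < k` and a far bundle on the
slice `c = 0` (hypotheses as in `real_section_sdiff_eq_zero_of_far_c0`) the pattern sum of
`Drho_eq_sum_half_pivotal_sub_defect` collapses to its top term `J = [k]`, the set-pivotality of the bundle: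
`Σ_{J ⊆ [k]} M_k(ρ,0)(A^J ∖ A^∅) = M_k(ρ,0)(ω ∪ B ∈ Aloc ∧ ω ∖ B ∉ Aloc)`.  So the far bundles of the
window contribute exactly `2^{-k} N_far ≤ 2^{-k} N` to the left side of (D0) (`θ_bulk = 2^{-k} < ½`). -/
theorem sum_real_section_sdiff_eq_pivotal_of_far_c0 : ∀ (k m : ℕ), 0 < k → ∀ (F : Fin m → Quad (Set.univ : Set ℂ)) {η r : ℝ}, 0 < η → 2 * η ≤ r → ∀ (ρ : ℝ) (t : Site 2) (d : Fin 2), (∀ j, j ≤ k → ∀ (i : Fin m) (jj : Fin 4), ∀ q ∈ (F i).side jj, r ≤ dist ((η : ℂ) * squareLatticeEmbedding.z (fun l => (k : ℤ) * t l + if l = d then (j : ℤ) else 0)) q) → ∑ J ∈ (Finset.range k).powerset, (M k ρ 0).real ({ω | ω \ edgeOf '' {vd : Site 2 × Fin 2 | ax k vd ∧ tb k vd = t ∧ vd.2 = d} ∪ ↑(J.image fun j : ℕ => edgeOf ((fun l => (k : ℤ) * t l + if l = d then (j : ℤ) else 0), d)) ∈ Aloc m F η} \ {ω | ω \ edgeOf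 '' {vd : Site 2 × Fin 2 | ax k vd ∧ tb k vd = t ∧ vd.2 = d} ∈ Aloc m F η}) = (M k ρ 0).real {ω | ω ∪ edgeOf '' {vd : Site 2 × Fin 2 | ax k vd ∧ tb k vd = t ∧ vd.2 = d} ∈ Aloc m F η ∧ ω \ edgeOf '' {vd : Site 2 × Fin 2 | ax k vd ∧ tb k vd = t ∧ vd.2 = d} ∉ Aloc m F η} := by
  intro k m hk F η r hη hηr ρ t d hfar
  classical
  have htop : Finset.range k ∈ (Finset.range k).powerset := Finset.mem_powerset.2 subset_rfl
  rw [Finset.sum_eq_single_of_mem _ htop fun J hJ hJne =>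
    real_section_sdiff_eq_zero_of_far_c0 k m F hη hηr ρ t d hfar J hJ hJne]
  obtain ⟨hw₁, hw₂, -⟩ := bundle_param_canonical hk t d
  rw [← coe_bundleFinset_eq_image k (w := fun j l => (k : ℤ) * t l + if l = d then (j : ℤ) else 0)
    hw₁ hw₂ rfl]
  simp only [Set.sdiff_union_self]
  rfl

end Summit.CriticalPhenomena.CardyFormulaZ2.Theorems.CardySelfRefinement

end
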